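import Literature.AnabelianGeometry.SemiGraphs.DecompositionGroupGeneral
import Literature.AnabelianGeometry.SemiGraphs.FiniteEtaleCoveringVertexAligned

/-!
# Vertex alignment pins the local base point: equal stabilisers, hence injective section maps
# ([SemiAnbd] Def. 2.2 (i) p. 23, Rem. 2.2.1 p. 24)

Mochizuki, *Semi-graphs of anabelioids*, Publ. RIMS **42** (2006) 221–322, §2: Def. 2.2 (i) p. 23
(the finite étale covering `ℋ → 𝒦` attached to `A ∈ B(𝒦)`: GLOBALLY `B(ℋ) = B(𝒦)_{/A}`, LOCALLY
`ℋ_w = (𝒦_u)_P` for a connected component `P` of `A_u`) and Rem. 2.2.1 p. 24 ("the image of each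
`Π_v` … in `Π_𝒢` is equal to the stabilizer of a compatible system of vertices")
[cite: MochizukiSemiAnbd2006, Rem. 2.2.1 p.24].

PROOF-ONLY companion (abc-iut cell, layer L3; FACT-LIST row F-1478 `remark_2_4_1_covering`, residual
(L) «print's finite étale coverings compose, local clause», sub-brick **(L-σ)** of abc-iut-w5-d041's
decomposition `HOME/staging/w5/w5-d041-g3/L-LOCAL-CLAUSE-DECOMPOSITION.md` §3–§4; seat abc-iut-w4-d079).
In the cell the global witness (`αψ : B(𝒦)_{/A} ⥲ B(ℋ)`, `ψ^* ≅ (A × −) ⋙ αψ`) and the local witness at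
a vertex `w ↦ u` (`α_w : (𝒦_u)_{/P} ⥲ ℋ_w`, `ψ_w^* ≅ (P × −) ⋙ α_w`) of a covering `ψ : ℋ → 𝒦` are
INDEPENDENT data; each determines a base point of the fibre functor `F` of `𝒦_u` — the global one
`a₀ ∈ F(A_u)` with `ι(Π_ℋ) = Stab_{Π_𝒦}(a₀)` ((D1), `DecompositionGroupGeneral`), the local one
`p₀ ∈ F(P)` with `ι_w(Π_w) = Stab_{Π_u}(p₀)` (the same dictionary inside `𝒦_u`) — and abc-iut-w5-d041's
SECTION MAP `σ_w : P ⟶ A_u` (`FiniteEtaleCoveringLocalGlobalSection`) sends `p₀ ↦ a₀`.  This file is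
the GROUP HALF of «`σ_w` is a monomorphism»:

* `comap_range_eq_range_of_aligned` — pure group theory: along a commuting square
  `Π_w → Π_u → Π_𝒦`, `Π_w → Π_ℋ → Π_𝒦`, clause (a) of vertex alignment `ι(Π_w) = ι(Π_ℋ) ⊓ Π_u`
  together with `ker(Π_u → Π_𝒦) ≤ ι_w(Π_w)` gives `(Π_u → Π_𝒦)⁻¹ ι(Π_ℋ) = ι_w(Π_w)`;
* `mono_of_stabilizer_le` — in a Galois category, a morphism `f : P ⟶ X` out of a CONNECTED object is
  a monomorphism as soon as `Stab(F f p) ≤ Stab(p)` for one point `p ∈ F(P)`;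
* `Hom.IsVertexAligned.stabilizer_eq_of_ranges` — **for a vertex-aligned `ψ`, `Stab_{Π_u}(a₀) =
  Stab_{Π_u}(p₀)`** for any `a₀ ∈ F(X_u)` whose `Π_𝒦`-stabiliser is `ι(Π_ℋ)` and any `p₀ ∈ F(P)`,
  `P ↪ X_u`, whose `Π_u`-stabiliser is `ι_w(Π_w)`;
* `Hom.IsVertexAligned.mono_of_map_eq` — **hence every `σ : P ⟶ X_u` with `F(σ)(p₀) = a₀`, `P`
  connected, is a monomorphism** (the consumer instantiates `σ := σ_w`).

No `def`, no new `Prop`; nothing here takes a side on [IUTchIII] Cor. 3.12.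
-/

namespace Literature.AnabelianGeometry.SemiGraphs

open CategoryTheory CategoryTheory.Limits CategoryTheory.PreGaloisCategory
open Literature.AnabelianGeometry.Anabelioids
open scoped Pointwise

universe v₁ u₁ u

/-! ### Part A. Group theory of the aligned square -/

section GroupTheory

variable {Γw ΓH Γu ΓK : Type*} [Group Γw] [Group ΓH] [Group Γu] [Group ΓK]

/-- **The aligned square pins the preimage.**  For homomorphisms `ι_w : Π_w → Π_u`, `j : Π_u → Π_𝒦`,
`k : Π_w → Π_ℋ`, `ι : Π_ℋ → Π_𝒦` with `j ∘ ι_w = ι ∘ k`, if `ι(k(Π_w)) = ι(Π_ℋ) ⊓ j(Π_u)` (clause (a)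
of vertex alignment) and `ker j ≤ ι_w(Π_w)`, then `j⁻¹(ι(Π_ℋ)) = ι_w(Π_w)`.
[cite: MochizukiSemiAnbd2006, Rem. 2.2.1 p.24] -/
theorem comap_range_eq_range_of_aligned (ι : ΓH →* ΓK) (j : Γu →* ΓK) (ιw : Γw →* Γu)
    (k : Γw →* ΓH) (hsq : j.comp ιw = ι.comp k) (ha : (ι.comp k).range = ι.range ⊓ j.range)
    (hker : j.ker ≤ ιw.range) : ι.range.comap j = ιw.range := by
  apply le_antisymm
  · intro g hg
    have h1 : j g ∈ (ι.comp k).range := by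
      rw [ha]
      exact ⟨hg, ⟨g, rfl⟩⟩
    rw [← hsq] at h1
    obtain ⟨h, hh⟩ := h1
    have h2 : (ιw h)⁻¹ * g ∈ j.ker := by
      rw [MonoidHom.mem_ker, map_mul, map_inv, ← MonoidHom.comp_apply, hh, inv_mul_cancel]
    have h3 : g = ιw h * ((ιw h)⁻¹ * g) := by group
    rw [h3]
    exact mul_mem ⟨h, rfl⟩ (hker h2)
  · rintro _ ⟨h, rfl⟩
    change j (ιw h) ∈ ι.range
    rw [← MonoidHom.comp_apply, hsq]
    exact ⟨k h, rfl⟩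

end GroupTheory

/-! ### Part B. Monomorphisms out of a connected object, read on one fibre -/

section Galois

universe w u₂ v₂

variable {C : Type u₂} [Category.{v₂} C] [GaloisCategory C] (F : C ⥤ FintypeCat.{w}) [FiberFunctor F]

omit [GaloisCategory C] [FiberFunctor F] in
/-- The fibre functor intertwines the `Aut F`-actions on fibres: `F(f)(σ • p) = σ • F(f)(p)`.
[cite: MochizukiGeoAn2004, Def. 1.1.2(ii) p.10] -/
theorem map_smul_aut {P X : C} (f : P ⟶ X) (σ : Aut F) (p : F.obj P) :
    F.map f (σ • p) = σ • F.map f p := by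
  simp only [mulAction_def]
  exact (FunctorToFintypeCat.naturality F F σ.hom f p).symm

/-- **A morphism out of a connected object is a monomorphism as soon as one point stabiliser does not
grow**: `P` connected, `p ∈ F(P)`, `Stab(F(f)(p)) ≤ Stab(p)` ⇒ `f` mono (the `Aut F`-orbit of `p` is all
of `F(P)`, so `F(f)` is injective, and fibre functors reflect monomorphisms).
[cite: MochizukiGeoAn2004, Prop. 1.1.4 p.11] -/
theorem mono_of_stabilizer_le {P X : C} [PreGaloisCategory.IsConnected P] (f : P ⟶ X) (p : F.obj P)
    (h : MulAction.stabilizer (Aut F) (F.map f p) ≤ MulAction.stabilizer (Aut F) p) : Mono f := by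
  have hinj : Function.Injective (F.map f) := by
    intro x y hxy
    obtain ⟨σ, rfl⟩ := MulAction.exists_smul_eq (Aut F) p x
    obtain ⟨τ, rfl⟩ := MulAction.exists_smul_eq (Aut F) p y
    rw [map_smul_aut, map_smul_aut] at hxy
    have hmem : τ⁻¹ * σ ∈ MulAction.stabilizer (Aut F) (F.map f p) := by
      rw [MulAction.mem_stabilizer_iff, mul_smul, hxy, inv_smul_smul]
    have h' := h hmem
    rw [MulAction.mem_stabilizer_iff, mul_smul, inv_smul_eq_iff] at h'
    exact h'
  haveI : Mono (F.map f) := ConcreteCategory.mono_of_injective _ hinj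
  exact F.mono_of_mono_map inferInstance

end Galois

/-! ### Part C. The covering: equal stabilisers from vertex alignment -/

namespace SemiGraphOfAnabelioids

namespace Hom

variable {ℋ 𝒦 : SemiGraphOfAnabelioids.{v₁, u₁, u}} {ψ : Hom ℋ 𝒦}

/-- The square `Π_w → Π_ℋ → Π_𝒦` = `Π_w → Π_u → Π_𝒦` at the level of automorphism groups of basepoints
(`ψ^* ⋙ ρ_w = ρ_u ⋙ ψ_w^*` definitionally), for ANY morphism `ψ` — the left leg is the `ι` of
`Hom.IsVertexAligned`, the right leg `Π_u → Π_𝒦` after `ι_w := Aut(e) ∘ π₁(ψ_w^*)`.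
[cite: MochizukiSemiAnbd2006, Rem. 2.2.1 p.24] -/
theorem ι_comp_piVToPi_eq_piVToPi_comp (ψ : Hom ℋ 𝒦) (w : ℋ.graph.Vertex)
    (F' : ℋ.V w ⥤ FintypeCat.{v₁}) (F : 𝒦.V (ψ.base.vertexMap w) ⥤ FintypeCat.{v₁})
    (e : (ψ.φV w).pullback ⋙ F' ≅ F) :
    ((Aut.autMulEquivOfIso (Functor.isoWhiskerLeft (𝒦.ρ (ψ.base.vertexMap w)) e)).toMonoidHom.comp
        (pi1Map ψ.pullbackFunctor (ℋ.ρ w ⋙ F'))).comp (ℋ.piVToPi w F') =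
      (𝒦.piVToPi (ψ.base.vertexMap w) F).comp
        ((Aut.autMulEquivOfIso e).toMonoidHom.comp (pi1Map (ψ.φV w).pullback F')) := by
  refine MonoidHom.ext fun x => Iso.ext (NatTrans.ext (funext fun X => ?_))
  rfl

/-- Through `Π_u → Π_𝒦 = Aut(ρ_u ⋙ F)`, the stabiliser in `Π_𝒦` of a point of the fibre
`(ρ_u ⋙ F)(X) = F(X_u)` pulls back to its stabiliser in `Π_u` (the action of `Π_u` on `F(X_u)` IS the
pulled-back one; no injectivity of `Π_u → Π_𝒦` is involved). [cite: MochizukiSemiAnbd2006, Rem. 2.2.1 p.24] -/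
theorem comap_piVToPi_stabilizer (u : 𝒦.graph.Vertex) (F : 𝒦.V u ⥤ FintypeCat.{v₁}) {X : 𝒦.BObj}
    (a : (𝒦.ρ u ⋙ F).obj X) :
    (MulAction.stabilizer (𝒦.Pi u F) a).comap (𝒦.piVToPi u F) =
      MulAction.stabilizer (𝒦.PiV u F) (show F.obj (X.S u) from a) := by
  ext g
  rfl

/-- The kernel of `Π_u → Π_𝒦` fixes every point of `F(P)` for `P ↪ X_u` a subobject of a RESTRICTED
object (it acts trivially on `F(X_u) ⊇ F(P)`). [cite: MochizukiSemiAnbd2006, Rem. 2.2.1 p.24] -/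
theorem ker_piVToPi_le_stabilizer (u : 𝒦.graph.Vertex) (F : 𝒦.V u ⥤ FintypeCat.{v₁}) [FiberFunctor F]
    {X : 𝒦.BObj} {P : 𝒦.V u} (m : P ⟶ X.S u) [Mono m] (p : F.obj P) :
    (𝒦.piVToPi u F).ker ≤ MulAction.stabilizer (𝒦.PiV u F) p := by
  intro g hg
  rw [MulAction.mem_stabilizer_iff]
  haveI : Mono (F.map m) := inferInstance
  have hinj : Function.Injective (F.map m) :=
    ConcreteCategory.injective_of_mono_of_preservesPullback (F.map m)
  apply hinj
  rw [map_smul_aut]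
  -- `g` acts on `F(X_u)` through `Π_𝒦`, where it is trivial
  have h1 : (𝒦.piVToPi u F g) • (show (𝒦.ρ u ⋙ F).obj X from F.map m p) = F.map m p := by
    rw [MonoidHom.mem_ker.mp hg, one_smul]
  exact h1

/-- **Vertex alignment ⇒ equal stabilisers of the two base points.**  Let `ψ : ℋ → 𝒦` be
vertex-aligned; at a vertex `w ↦ u` with basepoints `F′` of `ℋ_w`, `F` of `𝒦_u`, `e : ψ_w^* ⋙ F′ ≅ F`,
let `a₀ ∈ F(X_u)` be a point whose `Π_𝒦`-stabiliser is `Π′ = ι(Π_ℋ)` (the GLOBAL base point of the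
covering, (D1) `covering_decompositionGroup_of_isGlobalCoveringOf`) and `p₀ ∈ F(P)`, `P ↪ X_u`, a point
whose `Π_u`-stabiliser is `ι_w(Π_w)` (the LOCAL base point, the same dictionary in `𝒦_u`).  Then
`Stab_{Π_u}(a₀) = Stab_{Π_u}(p₀)`: clause (a) `ι(Π_w) = Π′ ⊓ Π_u` of `Hom.IsVertexAligned` read through
`comap_range_eq_range_of_aligned`. [cite: MochizukiSemiAnbd2006, Rem. 2.2.1 p.24] -/
theorem IsVertexAligned.stabilizer_eq_of_ranges (hva : ψ.IsVertexAligned) (w : ℋ.graph.Vertex)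
    (F' : ℋ.V w ⥤ FintypeCat.{v₁}) [FiberFunctor F']
    (F : 𝒦.V (ψ.base.vertexMap w) ⥤ FintypeCat.{v₁}) [FiberFunctor F]
    (e : (ψ.φV w).pullback ⋙ F' ≅ F) {X : 𝒦.BObj} (a₀ : (𝒦.ρ (ψ.base.vertexMap w) ⋙ F).obj X)
    (ha : ((Aut.autMulEquivOfIso (Functor.isoWhiskerLeft (𝒦.ρ (ψ.base.vertexMap w)) e)
        ).toMonoidHom.comp (pi1Map ψ.pullbackFunctor (ℋ.ρ w ⋙ F'))).range =
      MulAction.stabilizer (𝒦.Pi (ψ.base.vertexMap w) F) a₀)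
    {P : 𝒦.V (ψ.base.vertexMap w)} (m : P ⟶ X.S (ψ.base.vertexMap w)) [Mono m] (p₀ : F.obj P)
    (hp : ((Aut.autMulEquivOfIso e).toMonoidHom.comp (pi1Map (ψ.φV w).pullback F')).range =
      MulAction.stabilizer (𝒦.PiV (ψ.base.vertexMap w) F) p₀) :
    MulAction.stabilizer (𝒦.PiV (ψ.base.vertexMap w) F) (show F.obj (X.S (ψ.base.vertexMap w)) from a₀) =
      MulAction.stabilizer (𝒦.PiV (ψ.base.vertexMap w) F) p₀ := by
  obtain ⟨hclause, -⟩ := @hva w F' _ F ‹_› e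
  rw [← comap_piVToPi_stabilizer, ← ha, ← hp]
  refine comap_range_eq_range_of_aligned _ _ _ (ℋ.piVToPi w F')
    (ψ.ι_comp_piVToPi_eq_piVToPi_comp w F' F e).symm ?_ ?_
  · exact hclause
  · rw [hp]
    exact ker_piVToPi_le_stabilizer _ F m p₀

/-- **Vertex alignment ⇒ the section map is a monomorphism (group half of (L-σ)).**  In the situation
of `stabilizer_eq_of_ranges`, every morphism `σ : P ⟶ X_u` of `𝒦_u` with `F(σ)(p₀) = a₀` and `P`
connected is a monomorphism — the consumer takes `σ := σ_w`, abc-iut-w5-d041's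
`Hom.localGlobalSection` (which sends the local base point to the global one), and `P` a connected
component of `A_u`. [cite: MochizukiSemiAnbd2006, Rem. 2.2.1 p.24] -/
theorem IsVertexAligned.mono_of_map_eq (hva : ψ.IsVertexAligned) (w : ℋ.graph.Vertex)
    (F' : ℋ.V w ⥤ FintypeCat.{v₁}) [FiberFunctor F']
    (F : 𝒦.V (ψ.base.vertexMap w) ⥤ FintypeCat.{v₁}) [FiberFunctor F]
    (e : (ψ.φV w).pullback ⋙ F' ≅ F) {X : 𝒦.BObj} (a₀ : (𝒦.ρ (ψ.base.vertexMap w) ⋙ F).obj X)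
    (ha : ((Aut.autMulEquivOfIso (Functor.isoWhiskerLeft (𝒦.ρ (ψ.base.vertexMap w)) e)
        ).toMonoidHom.comp (pi1Map ψ.pullbackFunctor (ℋ.ρ w ⋙ F'))).range =
      MulAction.stabilizer (𝒦.Pi (ψ.base.vertexMap w) F) a₀)
    {P : 𝒦.V (ψ.base.vertexMap w)} [PreGaloisCategory.IsConnected P]
    (m : P ⟶ X.S (ψ.base.vertexMap w)) [Mono m]
    (p₀ : F.obj P)
    (hp : ((Aut.autMulEquivOfIso e).toMonoidHom.comp (pi1Map (ψ.φV w).pullback F')).range =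
      MulAction.stabilizer (𝒦.PiV (ψ.base.vertexMap w) F) p₀)
    (σ : P ⟶ X.S (ψ.base.vertexMap w))
    (hσ : F.map σ p₀ = (show F.obj (X.S (ψ.base.vertexMap w)) from a₀)) : Mono σ := by
  refine mono_of_stabilizer_le F σ p₀ ?_
  rw [hσ, hva.stabilizer_eq_of_ranges w F' F e a₀ ha m p₀ hp]

end Hom

end SemiGraphOfAnabelioids

end Literature.AnabelianGeometry.SemiGraphs
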